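import Summits.Ventures.QEC.CircuitDistance.ETowerK345X
import HarnessLib

/-!
# E-fold tower ([[144,12,12]] under CNOT order #345, W = 10) — sector X, WINDOW cubes (7, 0) … (7, 7)

#345 tower (STEP2-ASSEMBLY-SPEC §B7 shape). Each theorem certifies one scan WINDOW (`W3WIN3`) of the level-C fibre over one of the
13 low-weight `(6,6)` words `W3L` by `decide +kernel` (`nodeCW`, node K windows). No `native_decide`. Emitted with `emit_step2_345.py`.
Statements spelled with the sector-qualified names `Sec345X.nodeCW / Sec345X.W3L / Sec345X.W3WIN3|4` (same constants) so that their
text differs from the `[[144]]` sector-Z twins `SecZ.winZ_k_j` (gate dedup is textual; eng-1 g3).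
-/

set_option maxRecDepth 100000

namespace Summit.Ventures.QEC.CircuitDistance.ETower.Sec345X

set_option maxHeartbeats 400000000 in
/-- WINDOW FACT (§B7): the level-C fibre of `W3L[7]`, scan window `W3WIN3[0]`, passes. -/
theorem winX_7_0 : Sec345X.nodeCW (Sec345X.W3L.getD 7 []) (Sec345X.W3WIN3.getD 0 (0,0)) = true := by decide +kernel

set_option maxHeartbeats 400000000 in
/-- WINDOW FACT (§B7): the level-C fibre of `W3L[7]`, scan window `W3WIN3[1]`, passes. -/
theorem winX_7_1 : Sec345X.nodeCW (Sec345X.W3L.getD 7 []) (Sec345X.W3WIN3.getD 1 (0,0)) = true := by decide +kernel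

set_option maxHeartbeats 400000000 in
/-- WINDOW FACT (§B7): the level-C fibre of `W3L[7]`, scan window `W3WIN3[2]`, passes. -/
theorem winX_7_2 : Sec345X.nodeCW (Sec345X.W3L.getD 7 []) (Sec345X.W3WIN3.getD 2 (0,0)) = true := by decide +kernel

set_option maxHeartbeats 400000000 in
/-- WINDOW FACT (§B7): the level-C fibre of `W3L[7]`, scan window `W3WIN3[3]`, passes. -/
theorem winX_7_3 : Sec345X.nodeCW (Sec345X.W3L.getD 7 []) (Sec345X.W3WIN3.getD 3 (0,0)) = true := by decide +kernel

set_option maxHeartbeats 400000000 in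
/-- WINDOW FACT (§B7): the level-C fibre of `W3L[7]`, scan window `W3WIN3[4]`, passes. -/
theorem winX_7_4 : Sec345X.nodeCW (Sec345X.W3L.getD 7 []) (Sec345X.W3WIN3.getD 4 (0,0)) = true := by decide +kernel

set_option maxHeartbeats 400000000 in
/-- WINDOW FACT (§B7): the level-C fibre of `W3L[7]`, scan window `W3WIN3[5]`, passes. -/
theorem winX_7_5 : Sec345X.nodeCW (Sec345X.W3L.getD 7 []) (Sec345X.W3WIN3.getD 5 (0,0)) = true := by decide +kernel

set_option maxHeartbeats 400000000 in
/-- WINDOW FACT (§B7): the level-C fibre of `W3L[7]`, scan window `W3WIN3[6]`, passes. -/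
theorem winX_7_6 : Sec345X.nodeCW (Sec345X.W3L.getD 7 []) (Sec345X.W3WIN3.getD 6 (0,0)) = true := by decide +kernel

set_option maxHeartbeats 400000000 in
/-- WINDOW FACT (§B7): the level-C fibre of `W3L[7]`, scan window `W3WIN3[7]`, passes. -/
theorem winX_7_7 : Sec345X.nodeCW (Sec345X.W3L.getD 7 []) (Sec345X.W3WIN3.getD 7 (0,0)) = true := by decide +kernel

end Summit.Ventures.QEC.CircuitDistance.ETower.Sec345X
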